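import Mathlib
import Literature.AlgebraicGeometry.Tropical.InitialIdeal
import Literature.AlgebraicGeometry.Tropical.TropicalLink
import Summits.ResolutionOfSingularities.ResolutionOfSingularities.Theorems.TropicalLinksInductiveStepWeightZero
import Summits.ResolutionOfSingularities.ResolutionOfSingularities.Theorems.TropicalLinksInductiveStepRayFibreRange
import Summits.ResolutionOfSingularities.ResolutionOfSingularities.Theorems.TropicalLinksInductiveStepRayAlgebra
import Summits.ResolutionOfSingularities.ResolutionOfSingularities.Theorems.TropicalLinksInductiveStepRayAlgebraRegular
import Summits.ResolutionOfSingularities.ResolutionOfSingularities.Theorems.TropicalLinksInductiveStepLaurentKer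
import Summits.ResolutionOfSingularities.ResolutionOfSingularities.Theorems.TropicalLinksInductiveStepStratumChart

/-!
# TropicalLinks / InductiveStep — the ray fibre over a Luxton–Qu stratum chart is regular
# (roadmap brick G: the local-to-global interface)

Route `ResolutionOfSingularities/TropicalLinks`, crux `InductiveStep` (stmt-ResolutionOfSingularities-17233),
line `split`, in support of stub `stub_sncClosureSchon` (Luxton–Qu Prop. 3.1 through the dictionary
`tropicalLinks_isSchonIdeal_iff_forall_rayFibre`).  A STRATUM CHART for an ideal `J ⊆ k[ℤ × K]`
(`𝒪 := k[ℤ × K] ⧸ J` the coordinate ring of the very affine `U°`, the first coordinate the ray) is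
the algebraic content of a stratum `S` of an snc compactification with Luxton–Qu's conditions (1)–(2):
a `k`-algebra `A` (= `𝒪(Star S)`) with an injective `ιA : A →ₐ[k] 𝒪`, boundary equations
`m₁..m_l ∈ A`, positive weights `b` and a surjective `a : ℤ × K →+ ℤ^l` (orders of vanishing of the
monomials along the boundary divisors through `S`) such that `𝒪 = A[1/∏mᵢ]` (`hloc`), the ray is
`⟨b, a(·)⟩` (`hρ`), every monomial is a unit of `A` times `m^{a(w)}` (`hmon`), `A` is generated by the
monomials it contains (`hgen`), the `mᵢ` form a permutable regular family (`hperm`), `A` is Noetherian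
and the stratum `A ⧸ (m)` is regular.

* `tropicalLinks_forall_prime_regular_rayFibre_of_stratumChart` (registered brick G) — **under a stratum
  chart the ray fibre ring `k[K] ⧸ 𝔣(J)` of the dictionary is regular at every prime.**

Proof: one ring isomorphism `(A ⧸ (m))[↥ker ⟨b,·⟩] ≃ S ⧸ J_b ≃ B ⧸ (x₁) ≃ k[K] ⧸ 𝔣(J)` (bricks C1
`tropicalLinks_nonempty_rayAlgebra_quotient_algEquiv`, G1 `tropicalLinks_nonempty_rayAlgebra_quotient_ringEquiv_range_quotient`,
G0 `tropicalLinks_nonempty_rayFibre_algEquiv_range_quotient`), and the Laurent ring on the kernel lattice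
over the regular stratum is regular (C2 `tropicalLinks_forall_prime_regular_laurent_ker_iff`).  The
composite is built in one piece so that no quotient of a subalgebra appears as the source of
`IsRegularRing.of_ringEquiv` (instance-path trap recorded in the lead notes).  No new definitions.
-/

-- single-problem summit: the doubled namespace component `ResolutionOfSingularities` is forced
set_option linter.dupNamespace false

namespace Summit.ResolutionOfSingularities.ResolutionOfSingularities.Theorems

open AddMonoidAlgebra Literature.AlgebraicGeometry.Tropical

/-- **The ray fibre over a Luxton–Qu stratum chart is regular** (registered brick G; see the module
docstring for the meaning of the hypotheses). [folklore] -/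
theorem tropicalLinks_forall_prime_regular_rayFibre_of_stratumChart :
    ∀ (k : Type) [Field k] (K : Type) [AddCommGroup K] (J : Ideal (AddMonoidAlgebra k (ℤ × K))) (A : Type) [CommRing A] [Algebra k A] (ιA : A →ₐ[k] AddMonoidAlgebra k (ℤ × K) ⧸ J) (l : ℕ) (m : Fin l → A) (b : Fin l → ℕ) (a : (ℤ × K) →+ (Fin l → ℤ)), Function.Injective ιA → (∀ y : AddMonoidAlgebra k (ℤ × K) ⧸ J, ∃ (x : A) (n : ℕ), y * ιA (∏ i, m i) ^ n = ιA x) → (∀ i, 0 < b i) → Function.Surjective a → (∀ w : ℤ × K, w.1 = ∑ i, (b i : ℤ) * a w i) → (∀ w : ℤ × K, ∃ ε : Aˣ, Ideal.Quotient.mk J (AddMonoidAlgebra.single w (1 : k)) * ιA (∏ i, m i ^ (-(a w i)).toNat) = ιA ((ε : A) * ∏ i, m i ^ (a w i).toNat)) → ιA.range = Algebra.adjoin k {x : AddMonoidAlgebra k (ℤ × K) ⧸ J | ∃ w : ℤ × K, (∀ i, 0 ≤ a w i) ∧ x = Ideal.Quotient.mk J (AddMonoidAlgebra.single w (1 : k))}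 → (∀ (i : Fin l) (T : Set (Fin l)), i ∉ T → ∀ y : A, m i * y ∈ Ideal.span (m '' T) → y ∈ Ideal.span (m '' T)) → IsNoetherianRing A → (∀ (P : Ideal (A ⧸ Ideal.span (Set.range m))) [P.IsPrime], IsRegularLocalRing (Localization.AtPrime P)) → ∀ (P : Ideal (AddMonoidAlgebra k K ⧸ Literature.AlgebraicGeometry.Tropical.linkIdeal (AddMonoidHom.inr ℕ K) (Literature.AlgebraicGeometry.Tropical.linkIdeal ((Nat.castAddMonoidHom ℤ).prodMap (AddMonoidHom.id K)) J ⊔ Ideal.span {AddMonoidAlgebra.single ((1 : ℕ), (0 : K)) (1 : k)}))) [P.IsPrime], IsRegularLocalRing (Localization.AtPrime P) := by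
  intro k _ K _ J A _ _ ιA l m b a hinj hloc hb hsurj hρ hmon hgen hperm hN hreg P _
  -- the units `v i = m i` of `L = A[1/∏ m]`
  have hu : ∀ i, IsUnit (algebraMap A (Localization.Away (∏ i, m i)) (m i)) := fun i =>
    isUnit_of_dvd_unit (map_dvd _ (Finset.dvd_prod_of_mem m (Finset.mem_univ i)))
      (IsLocalization.Away.algebraMap_isUnit (S := Localization.Away (∏ i, m i)) (∏ i, m i))
  let v : Fin l → (Localization.Away (∏ i, m i))ˣ := fun i => (hu i).unit
  have hv : ∀ i, (v i : Localization.Away (∏ i, m i)) = algebraMap A _ (m i) := fun i => (hu i).unit_spec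
  clear_value v
  -- keep the ray algebra, its fibre ideal and the image algebra OPAQUE (instance search on quotients
  -- of subalgebras does not survive the unfolded set-builder terms)
  set S : Subalgebra A (Localization.Away (∏ i, m i)) := Algebra.adjoin A
    {x : Localization.Away (∏ i, m i) | ∃ c : Fin l → ℤ, 0 ≤ ∑ i, (b i : ℤ) * c i ∧
      x = ((∏ i, v i ^ c i : (Localization.Away (∏ i, m i))ˣ) : Localization.Away (∏ i, m i))} with hS
  clear_value S
  set Jb : Ideal ↥S := Ideal.span {x : ↥S | ∃ c : Fin l → ℤ, 0 < ∑ i, (b i : ℤ) * c i ∧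
      (x : Localization.Away (∏ i, m i)) =
        ((∏ i, v i ^ c i : (Localization.Away (∏ i, m i))ˣ) : Localization.Away (∏ i, m i))} with hJb
  clear_value Jb
  set B : Subalgebra k (AddMonoidAlgebra k (ℤ × K) ⧸ J) := ((Ideal.Quotient.mkₐ k J).comp
    (AddMonoidAlgebra.mapDomainAlgHom k k ((Nat.castAddMonoidHom ℤ).prodMap (AddMonoidHom.id K)))).range
    with hB
  clear_value B
  obtain ⟨eG0⟩ := tropicalLinks_nonempty_rayFibre_algEquiv_range_quotient k K J B hB
  obtain ⟨eG1⟩ := tropicalLinks_nonempty_rayAlgebra_quotient_ringEquiv_range_quotient k K J A ιA l m b a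
    hinj hloc hsurj hρ hmon hgen v hv S hS Jb hJb B hB
  obtain ⟨e₁⟩ := tropicalLinks_nonempty_rayAlgebra_quotient_algEquiv A l m b hb hperm v hv S hS Jb hJb
  -- ONE composite isomorphism `(A ⧸ (m))[ker b] ≃ S ⧸ J_b ≃ B ⧸ (x₁) ≃ k[K] ⧸ 𝔣(J)`
  have comp : AddMonoidAlgebra (A ⧸ Ideal.span (Set.range m))
      ↥(AddMonoidHom.ker (dotWeightHom fun i => (b i : ℤ))) ≃+*
      (AddMonoidAlgebra k K ⧸ linkIdeal (AddMonoidHom.inr ℕ K)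
        (linkIdeal ((Nat.castAddMonoidHom ℤ).prodMap (AddMonoidHom.id K)) J ⊔
          Ideal.span {single ((1 : ℕ), (0 : K)) (1 : k)})) :=
    e₁.symm.toRingEquiv.trans (eG1.trans eG0.symm.toRingEquiv)
  haveI hNK : IsNoetherianRing (AddMonoidAlgebra (A ⧸ Ideal.span (Set.range m))
      ↥(AddMonoidHom.ker (dotWeightHom fun i => (b i : ℤ)))) :=
    tropicalLinks_isNoetherianRing_laurent_ker _ _
  have hregK : ∀ (Q : Ideal (AddMonoidAlgebra (A ⧸ Ideal.span (Set.range m))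
      ↥(AddMonoidHom.ker (dotWeightHom fun i => (b i : ℤ))))) [Q.IsPrime],
      IsRegularLocalRing (Localization.AtPrime Q) := by
    rcases Nat.eq_zero_or_pos l with hl | hl
    · subst hl
      haveI : Subsingleton ↥(AddMonoidHom.ker (dotWeightHom fun i : Fin 0 => (b i : ℤ))) :=
        ⟨fun x y => Subtype.ext (Subsingleton.elim _ _)⟩
      exact tropicalLinks_forall_prime_regular_of_ringEquiv
        (AddMonoidAlgebra.uniqueRingEquiv (R := A ⧸ Ideal.span (Set.range m))
          ↥(AddMonoidHom.ker (dotWeightHom fun i : Fin 0 => (b i : ℤ)))).symm hreg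
    · have hb0 : (fun i => (b i : ℤ)) ≠ 0 := by
        intro h
        have h0 := congrFun h ⟨0, hl⟩
        simp only [Pi.zero_apply, Nat.cast_eq_zero] at h0
        exact (hb _).ne' h0
      exact (tropicalLinks_forall_prime_regular_laurent_ker_iff (A ⧸ Ideal.span (Set.range m)) l _ hb0
        inferInstance).2 hreg
  haveI : IsRegularRing (AddMonoidAlgebra (A ⧸ Ideal.span (Set.range m))
      ↥(AddMonoidHom.ker (dotWeightHom fun i => (b i : ℤ)))) := isRegularRing_iff.2 hregK
  haveI := IsRegularRing.of_ringEquiv comp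
  exact IsRegularRing.isRegularLocalRing_localization P

end Summit.ResolutionOfSingularities.ResolutionOfSingularities.Theorems
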